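import Mathlib.Analysis.InnerProductSpace.GramSchmidtOrtho
import Mathlib.Analysis.InnerProductSpace.PiL2
import Mathlib.Analysis.CStarAlgebra.Matrix
import Mathlib.LinearAlgebra.UnitaryGroup
import Mathlib.LinearAlgebra.Matrix.Block
import Mathlib.LinearAlgebra.Matrix.GeneralLinearGroup.Defs
import Mathlib.Topology.Algebra.Star.Unitary
import Mathlib.Topology.Instances.Matrix
import HarnessLib

/-!
# The archimedean Iwasawa decomposition `GL_n(𝕜) = B⁺ · U(n)` (`𝕜 = ℝ` or `ℂ`) and compactness of `U(n)`

Topic `NumberTheory/Automorphic`. For `𝕜` a real-closed-like field (`RCLike 𝕜`, i.e. `ℝ` or `ℂ`)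
and `n : ℕ` we prove, Mathlib only:

* `Matrix.exists_blockTriangular_mul_mem_unitaryGroup` (**Iwasawa / Gram–Schmidt / `QR`
  decomposition in the form `g = b k`**): every invertible `g ∈ M_n(𝕜)` is `g = b * k` with `b`
  upper triangular (`Matrix.BlockTriangular b id`) with *positive real* diagonal entries and `k` in
  the unitary group `U(n) = Matrix.unitaryGroup (Fin n) 𝕜` (the orthogonal group `O(n)` when
  `𝕜 = ℝ`). This is Garrett, *Modern Analysis of Automorphic Forms by Example* (2018),
  Claim 3.2.1, `G_v = P_v · K_v` at an archimedean place `v` ("the right action of `K_v` rotates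
  the rows of `g`"), i.e. the `G = N A K` Iwasawa decomposition of `GL_n(ℝ)`, `GL_n(ℂ)` (Knapp,
  *Lie Groups Beyond an Introduction* (2002), Ch. VI §4) read in the order `B K` used by reduction
  theory (Siegel sets `𝔖 = C · M_t · K`, Garrett §3.3); the normalisation of the diagonal of `b`
  to positive reals (absorbing diagonal unitaries into `k`) is the standard refinement.
* `Matrix.exists_unitriangular_mul_diagonal_mul_mem_unitaryGroup`: the `N A K` form
  `g = u · diag(d) · k`, `u` upper unitriangular, `d` positive real, `k` unitary (the shape
  `n m k` of the elements of a Siegel set, Garrett (2018), §3.3).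
* `Matrix.GeneralLinearGroup.exists_upperTriangularPos_mul_unitary`: the `B K` form for
  `g : GL (Fin n) 𝕜`, with both factors in `GL (Fin n) 𝕜`.
* `EuclideanSpace.norm_toLp_vecMul_of_mem_unitaryGroup`: `‖x k‖₂ = ‖x‖₂` for `k ∈ U(n)` and a
  row vector `x` — the invariance of the archimedean local heights under `K_v` (Garrett (2018),
  proof of Claim 3.3.2).
* `Matrix.isCompact_unitaryGroup`: `U(n, 𝕜)` is compact (closed — Mathlib `isClosed_unitary` — and
  entrywise bounded by `1` — Mathlib `entry_norm_bound_of_unitary` — inside the compact box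
  `∏_{i,j} closedBall 0 1` of the product topology); the compactness of `K_v` at archimedean `v`
  used throughout Garrett (2018), §3.2–3.3.

## Proof of the decomposition

Mathlib's Gram–Schmidt process yields, for a family `f : Fin n → E` spanning the `n`-dimensional
inner product space `E`, an orthonormal basis `q = gramSchmidtOrthonormalBasis h f` whose
coefficient matrix `(q.repr (f j) i)_{i j}` is upper triangular
(`gramSchmidtOrthonormalBasis_inv_triangular'`), with diagonal `q.repr (f j) j = ‖f*_j‖ > 0`
(`f*` the un-normalised Gram–Schmidt vectors; `repr_gramSchmidtOrthonormalBasis_self` below).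
Applied in `E = EuclideanSpace 𝕜 (Fin n)` to the *rows of `g` in reverse order*,
`f j = g_{rev j}`, this says `g_a = ∑_{c ≥ a} b_{a c} k_c` where `k_c = q_{rev c}` (orthonormal rows,
so `k kᴴ = 1`) and `b_{a c} = q.repr (f (rev a)) (rev c)` vanishes for `c < a`; i.e. `g = b k`.
(The more common column version `g = Q R` is Mathlib's
`gramSchmidtOrthonormalBasis_inv_blockTriangular`; the row-reversed bookkeeping is what puts the
triangular factor on the left without inverting matrices.)

## What is not here

Uniqueness of the decomposition (`B⁺ ∩ U(n) = 1`), the `K A N` order, and the transport to the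
completions `K_w` of a number field at its infinite places (`K_w ≃+* ℝ` or `ℂ`,
Mathlib `NumberField.InfinitePlace.Completion`) are left to the consumers (reduction theory for
`GL_n` over number fields, Siegel sets). No `def` is introduced.

## References

* P. Garrett, *Modern Analysis of Automorphic Forms by Example*, Cambridge Stud. Adv. Math. 173
  (2018), §3.2, Claim 3.2.1 (`G_v = P_v · K_v`), chunk p0159 of the held copy [Garrett2018].
* A. W. Knapp, *Lie Groups Beyond an Introduction*, 2nd ed., Progress in Math. 140, Birkhäuser
  (2002), Ch. VI §4 (Iwasawa decomposition) [Knapp2002].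
-/

noncomputable section

open Matrix InnerProductSpace Module
open scoped InnerProductSpace

namespace Literature.NumberTheory.Automorphic

/-! ### The diagonal of the Gram–Schmidt coefficient matrix -/

section GramSchmidt

variable {𝕜 : Type*} [RCLike 𝕜] {E : Type*} [NormedAddCommGroup E] [InnerProductSpace 𝕜 E]
  {ι : Type*} [LinearOrder ι] [LocallyFiniteOrderBot ι] [WellFoundedLT ι]

/-- `⟪f*_i, f_i⟫ = ‖f*_i‖²` for the Gram–Schmidt vectors `f* = gramSchmidt 𝕜 f`: `f_i - f*_i` lies in
the span of the `f*_j`, `j < i`, which are orthogonal to `f*_i` (Mathlib `gramSchmidt_def''`,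
`gramSchmidt_orthogonal`). [folklore] -/
theorem inner_gramSchmidt_self (f : ι → E) (i : ι) :
    ⟪gramSchmidt 𝕜 f i, f i⟫_𝕜 = ((‖gramSchmidt 𝕜 f i‖ ^ 2 : ℝ) : 𝕜) := by
  conv_lhs => rw [gramSchmidt_def'' 𝕜 f i]
  rw [inner_add_right, inner_sum, Finset.sum_eq_zero, add_zero, inner_self_eq_norm_sq_to_K]
  · norm_cast
  · intro j hj
    rw [inner_smul_right, gramSchmidt_orthogonal 𝕜 f (Finset.mem_Iio.mp hj).ne', mul_zero]

/-- `⟪e_i, f_i⟫ = ‖f*_i‖` for the normalised Gram–Schmidt vectors `e = gramSchmidtNormed 𝕜 f` of a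
linearly independent family (so `‖f*_i‖ ≠ 0`). [folklore] -/
theorem inner_gramSchmidtNormed_self {f : ι → E} (h₀ : LinearIndependent 𝕜 f) (i : ι) :
    ⟪gramSchmidtNormed 𝕜 f i, f i⟫_𝕜 = ((‖gramSchmidt 𝕜 f i‖ : ℝ) : 𝕜) := by
  have hne : (‖gramSchmidt 𝕜 f i‖ : 𝕜) ≠ 0 := by
    exact_mod_cast (norm_ne_zero_iff.mpr (gramSchmidt_ne_zero i h₀))
  rw [gramSchmidtNormed, inner_smul_left, inner_gramSchmidt_self, map_inv₀, RCLike.conj_ofReal]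
  push_cast
  field_simp

variable [Fintype ι] [FiniteDimensional 𝕜 E]

/-- **The diagonal of the `QR` coefficient matrix.** For a linearly independent family `f` with
`card ι = dim E`, the `i`-th coordinate of `f i` in the Gram–Schmidt orthonormal basis is the
positive real number `‖f*_i‖` (Mathlib `gramSchmidtOrthonormalBasis_apply`,
`OrthonormalBasis.repr_apply_apply`). [folklore] -/
theorem repr_gramSchmidtOrthonormalBasis_self (h : finrank 𝕜 E = Fintype.card ι) {f : ι → E}
    (h₀ : LinearIndependent 𝕜 f) (i : ι) :
    (gramSchmidtOrthonormalBasis h f).repr (f i) i = ((‖gramSchmidt 𝕜 f i‖ : ℝ) : 𝕜) := by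
  have hne : gramSchmidtNormed 𝕜 f i ≠ 0 := by
    intro h0
    have h1 := gramSchmidtNormed_unit_length (𝕜 := 𝕜) i h₀
    rw [h0, norm_zero] at h1
    exact zero_ne_one h1
  rw [OrthonormalBasis.repr_apply_apply, gramSchmidtOrthonormalBasis_apply h hne,
    inner_gramSchmidtNormed_self h₀]

end GramSchmidt

/-! ### The Iwasawa decomposition `g = b k` of an invertible real or complex matrix -/

section Iwasawa

variable {𝕜 : Type*} [RCLike 𝕜] {n : ℕ}

/-- **Archimedean Iwasawa decomposition, `B K` form** (Gram–Schmidt): every invertible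
`g ∈ M_n(𝕜)`, `𝕜 = ℝ` or `ℂ`, factors as `g = b * k` with `b` upper triangular with positive real
diagonal and `k ∈ U(n)` unitary (orthogonal for `𝕜 = ℝ`): Garrett (2018), Claim 3.2.1
(`G_v = P_v · K_v`, archimedean `v`), with the diagonal of `b` normalised to be positive real;
Knapp (2002), Ch. VI §4 (`G = KAN`, read as `G = NAK = B⁺K` after `g ↦ g⁻¹`).
Proof: Gram–Schmidt on the rows of `g` in reverse order (module docstring). [cite: Garrett2018, Claim 3.2.1] -/
theorem Matrix.exists_blockTriangular_mul_mem_unitaryGroup (g : Matrix (Fin n) (Fin n) 𝕜)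
    (hg : IsUnit g) :
    ∃ (b k : Matrix (Fin n) (Fin n) 𝕜) (d : Fin n → ℝ), b.BlockTriangular id ∧ (∀ i, 0 < d i) ∧
      (∀ i, b i i = d i) ∧ k ∈ Matrix.unitaryGroup (Fin n) 𝕜 ∧ g = b * k := by
  classical
  -- the rows of `g` in reverse order, as vectors of the Euclidean space `E = 𝕜ⁿ`
  set f : Fin n → EuclideanSpace 𝕜 (Fin n) := fun j => WithLp.toLp 2 (g (Fin.rev j)) with hf
  have hrows : LinearIndependent 𝕜 (fun j : Fin n => g (Fin.rev j)) :=
    (Matrix.linearIndependent_rows_of_isUnit hg).comp Fin.rev Fin.rev_injective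
  have hli : LinearIndependent 𝕜 f :=
    LinearIndependent.of_comp (WithLp.linearEquiv 2 𝕜 (Fin n → 𝕜)).toLinearMap hrows
  have h : finrank 𝕜 (EuclideanSpace 𝕜 (Fin n)) = Fintype.card (Fin n) := finrank_euclideanSpace
  set q := gramSchmidtOrthonormalBasis h f with hq
  -- `b_{a c} = ⟨q_{rev c}, f_{rev a}⟩`, `k_c = q_{rev c}`
  refine ⟨Matrix.of fun a c => q.repr (f (Fin.rev a)) (Fin.rev c),
    Matrix.of fun c m => q (Fin.rev c) m, fun i => ‖gramSchmidt 𝕜 f (Fin.rev i)‖,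
    ?_, ?_, ?_, ?_, ?_⟩
  · -- upper triangular: for `c < a`, `rev a < rev c` and the coefficient vanishes
    intro a c hca
    exact gramSchmidtOrthonormalBasis_inv_triangular' h f (Fin.rev_lt_rev.mpr hca)
  · intro i
    exact norm_pos_iff.mpr (gramSchmidt_ne_zero _ hli)
  · intro i
    exact repr_gramSchmidtOrthonormalBasis_self h hli (Fin.rev i)
  · -- the rows of `k` are orthonormal: `k kᴴ = 1`
    rw [Matrix.mem_unitaryGroup_iff]
    ext c d
    rw [Matrix.mul_apply, Matrix.one_apply]
    have hcd : ⟪q (Fin.rev d), q (Fin.rev c)⟫_𝕜 = if c = d then 1 else 0 := by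
      rw [orthonormal_iff_ite.mp q.orthonormal]
      by_cases hcd : c = d
      · simp [hcd]
      · simp [hcd, Ne.symm hcd]
    rw [← hcd, EuclideanSpace.inner_eq_star_dotProduct, dotProduct]
    rfl
  · -- `g = b k`: expand `f (rev a)` in the orthonormal basis `q`
    ext a m
    rw [Matrix.mul_apply]
    have hsum := q.sum_repr (f (Fin.rev a))
    have hsum' := congrArg (fun v : EuclideanSpace 𝕜 (Fin n) => v m) hsum
    simp only [WithLp.ofLp_sum, Finset.sum_apply, WithLp.ofLp_smul, Pi.smul_apply,
      smul_eq_mul] at hsum'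
    rw [show (f (Fin.rev a)) m = g a m by simp [hf]] at hsum'
    rw [← hsum']
    simp only [Matrix.of_apply]
    exact Fintype.sum_equiv Fin.revPerm _ _ fun i => by simp only [Fin.revPerm_apply, Fin.rev_rev]

/-- **Archimedean Iwasawa decomposition, `N A K` form**: every invertible `g ∈ M_n(𝕜)` is
`g = u * diagonal d * k` with `u` upper unitriangular (`u` upper triangular, `u i i = 1`),
`d` a positive real diagonal and `k ∈ U(n)` (from the `B K` form: `u = b · diag(d)⁻¹`;
Garrett (2018), Claim 3.2.1 with `P^min = N^min M^min`, §3.1; Knapp (2002), Ch. VI §4, `G = KAN`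
up to `g ↦ g⁻¹`). This is the shape `n m k` of the elements of a Siegel set (Garrett (2018), §3.3).
[cite: Garrett2018, Claim 3.2.1] -/
theorem Matrix.exists_unitriangular_mul_diagonal_mul_mem_unitaryGroup
    (g : Matrix (Fin n) (Fin n) 𝕜) (hg : IsUnit g) :
    ∃ (u k : Matrix (Fin n) (Fin n) 𝕜) (d : Fin n → ℝ), u.BlockTriangular id ∧ (∀ i, u i i = 1) ∧
      (∀ i, 0 < d i) ∧ k ∈ Matrix.unitaryGroup (Fin n) 𝕜 ∧
      g = u * Matrix.diagonal (fun i => (d i : 𝕜)) * k := by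
  obtain ⟨b, k, d, hb, hd, hbd, hk, hgbk⟩ := Matrix.exists_blockTriangular_mul_mem_unitaryGroup g hg
  have hd0 : ∀ i, (d i : 𝕜) ≠ 0 := fun i => by exact_mod_cast (hd i).ne'
  refine ⟨b * Matrix.diagonal fun i => (d i : 𝕜)⁻¹, k, d,
    hb.mul (Matrix.blockTriangular_diagonal _), fun i => ?_, hd, hk, ?_⟩
  · rw [Matrix.mul_diagonal, hbd i, mul_inv_cancel₀ (hd0 i)]
  · have h1 : (Matrix.diagonal fun i => (d i : 𝕜)⁻¹) * (Matrix.diagonal fun i => (d i : 𝕜)) = 1 := by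
      rw [Matrix.diagonal_mul_diagonal, ← Matrix.diagonal_one]
      exact congrArg Matrix.diagonal (funext fun i => inv_mul_cancel₀ (hd0 i))
    rw [Matrix.mul_assoc b, h1, Matrix.mul_one]
    exact hgbk

/-- **Archimedean Iwasawa decomposition in `GL_n(𝕜)`**: every `g ∈ GL_n(𝕜)` (`𝕜 = ℝ` or `ℂ`) is
`g = b * k` in `GL_n(𝕜)` with `b` upper triangular with positive real diagonal entries and `k`
unitary (Garrett (2018), Claim 3.2.1: `G_v = P_v · K_v` for archimedean `v`; Knapp (2002),
Ch. VI §4). [cite: Garrett2018, Claim 3.2.1] -/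
theorem Matrix.GeneralLinearGroup.exists_upperTriangularPos_mul_unitary (g : GL (Fin n) 𝕜) :
    ∃ (b k : GL (Fin n) 𝕜) (d : Fin n → ℝ), (b : Matrix (Fin n) (Fin n) 𝕜).BlockTriangular id ∧
      (∀ i, 0 < d i) ∧ (∀ i, (b : Matrix (Fin n) (Fin n) 𝕜) i i = d i) ∧
      (k : Matrix (Fin n) (Fin n) 𝕜) ∈ Matrix.unitaryGroup (Fin n) 𝕜 ∧ g = b * k := by
  obtain ⟨b, k, d, hb, hd, hbd, hk, hgbk⟩ :=
    Matrix.exists_blockTriangular_mul_mem_unitaryGroup (g : Matrix (Fin n) (Fin n) 𝕜) g.isUnit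
  have hku : IsUnit k := ⟨⟨k, star k, Matrix.mem_unitaryGroup_iff.mp hk,
    Matrix.mem_unitaryGroup_iff'.mp hk⟩, rfl⟩
  have hbu : IsUnit b := by
    have h1 : IsUnit (b * k).det := (Matrix.isUnit_iff_isUnit_det _).mp (hgbk ▸ g.isUnit)
    rw [Matrix.det_mul] at h1
    exact (Matrix.isUnit_iff_isUnit_det b).mpr (isUnit_of_mul_isUnit_left h1)
  refine ⟨hbu.unit, hku.unit, d, by simpa using hb, hd, by simpa using hbd, by simpa using hk, ?_⟩
  ext1
  simpa using hgbk

end Iwasawa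

/-! ### Unitary matrices preserve the Euclidean norm of row vectors -/

section RowNorm

variable {𝕜 : Type*} [RCLike 𝕜] {ι : Type*} [Fintype ι] [DecidableEq ι]

/-- **`K_v` preserves the archimedean local height**: for `k ∈ U(n)` and a row vector `x`,
`‖x k‖₂ = ‖x‖₂` in the Euclidean space `𝕜ⁿ` (`⟪x k, x k⟫ = x k kᴴ x̄ᵀ = x x̄ᵀ`). This is the
invariance `h_v(x k) = h_v(x)` of the local heights `h_v(x) = (∑ |x_i|²)^{1/2}` (real `v`) and
`h_v(x) = ∑ |x_i|_ℂ` (complex `v`, the square of the Euclidean norm) under the right action of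
`K_v`, used in reduction theory (Garrett (2018), proof of Claim 3.3.2: "since `K = K_𝔸` preserves
heights"). [cite: Garrett2018, Claim 3.3.2 (proof)] -/
theorem EuclideanSpace.norm_toLp_vecMul_of_mem_unitaryGroup (x : ι → 𝕜) {k : Matrix ι ι 𝕜}
    (hk : k ∈ Matrix.unitaryGroup ι 𝕜) :
    ‖(WithLp.toLp 2 (x ᵥ* k) : EuclideanSpace 𝕜 ι)‖ = ‖(WithLp.toLp 2 x : EuclideanSpace 𝕜 ι)‖ := by
  have h : ⟪(WithLp.toLp 2 (x ᵥ* k) : EuclideanSpace 𝕜 ι), WithLp.toLp 2 (x ᵥ* k)⟫_𝕜 =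
      ⟪(WithLp.toLp 2 x : EuclideanSpace 𝕜 ι), WithLp.toLp 2 x⟫_𝕜 := by
    rw [EuclideanSpace.inner_toLp_toLp, EuclideanSpace.inner_toLp_toLp, Matrix.star_vecMul,
      ← Matrix.dotProduct_mulVec, Matrix.mulVec_mulVec, ← Matrix.star_eq_conjTranspose,
      Matrix.mem_unitaryGroup_iff.mp hk, Matrix.one_mulVec]
  rw [norm_eq_sqrt_re_inner (𝕜 := 𝕜), h, ← norm_eq_sqrt_re_inner]

end RowNorm

/-! ### Compactness of the unitary group -/

section Compact

variable {𝕜 : Type*} [RCLike 𝕜] {ι : Type*} [Fintype ι] [DecidableEq ι]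

/-- **`U(n)` is compact** (`O(n)` for `𝕜 = ℝ`): the unitary group of `M_ι(𝕜)` is a closed subset
(Mathlib `isClosed_unitary`) of the compact box of matrices with entries of norm `≤ 1`
(Mathlib `entry_norm_bound_of_unitary`, Tychonoff `isCompact_univ_pi` in the product topology of
`Matrix ι ι 𝕜`); the compactness of the archimedean `K_v` of Garrett (2018), §3.2. [folklore] -/
theorem Matrix.isCompact_unitaryGroup :
    IsCompact (Matrix.unitaryGroup ι 𝕜 : Set (Matrix ι ι 𝕜)) := by
  -- the compact box `{A | ∀ i j, ‖A i j‖ ≤ 1}`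
  set box : Set (Matrix ι ι 𝕜) :=
    Set.univ.pi fun _ : ι => Set.univ.pi fun _ : ι => Metric.closedBall (0 : 𝕜) 1 with hbox
  have hbox_c : IsCompact box :=
    isCompact_univ_pi fun _ => isCompact_univ_pi fun _ => isCompact_closedBall (0 : 𝕜) 1
  refine hbox_c.of_isClosed_subset isClosed_unitary fun U hU =>
    Set.mem_univ_pi.mpr fun i => Set.mem_univ_pi.mpr fun j => ?_
  rw [Metric.mem_closedBall, dist_zero_right]
  exact entry_norm_bound_of_unitary hU i j

end Compact

end Literature.NumberTheory.Automorphic
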